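import Literature.Analysis.OperatorTheory.FiniteRankCapacitance
import HarnessLib

/-!
# Norm of the finite-rank Woodbury correction from three certified ℓ²-type bounds

Topic `Literature/Analysis/OperatorTheory`; proofs-layer file. In the capacitance recipe
(`CapacitanceResolventBound.lean`) the inverse of `L − z` is `B + K` with the finite-rank correction
`K = finiteRank w (fun i => ∑ j, N i j • φ j)`, `K y = ∑ i, (N *ᵥ (φ · y)) i • w i`
(`w i = B (f i)` the solves, `φ j = g j ∘ B` the composed functionals, `N = (1 − C)⁻¹`).
Its operator norm is bounded by the product of three quantities a validated computation certifies separately: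
a synthesis bound `‖∑ c i • w i‖ ≤ γ (∑ ‖c i‖²)^{1/2}` (in Hilbert space: `γ² = λ_max` of the Gram matrix of the `w i`),
an analysis bound `(∑ ‖φ j y‖²)^{1/2} ≤ γ' ‖y‖` (Bessel-type; `γ'² = λ_max` of the Gram matrix of the representers),
and an ℓ²-operator-norm bound `ν` for the matrix `N`. Then `‖K‖ ≤ γ ν γ'` (`norm_finiteRank_mulVec_le`).
Pure normed-space statement; no inner product is used. [folklore] (Bessel / Gram bounds: Kato 1966, I-§6.3, V-§2.1.)
-/

namespace Literature.Analysis.OperatorTheory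

open scoped BigOperators
open Matrix

variable {𝕜 : Type*} [NontriviallyNormedField 𝕜]
variable {E : Type*} [NormedAddCommGroup E] [NormedSpace 𝕜 E]
variable {ι : Type*} [Fintype ι]

/-- The combined functionals of the Woodbury correction evaluate to a matrix–vector product:
`(∑ j, N i j • φ j) y = (N *ᵥ (φ · y)) i`. [folklore] -/
theorem sum_smul_apply_eq_mulVec (φ : ι → E →L[𝕜] 𝕜) (N : Matrix ι ι 𝕜) (y : E) (i : ι) :
    (∑ j, N i j • φ j) y = (N *ᵥ fun j => φ j y) i := by
  simp [Matrix.mulVec, dotProduct, smul_eq_mul]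

/-- **Norm of the finite-rank correction.** If `‖∑ i, c i • w i‖ ≤ γ √(∑ ‖c i‖²)` for all coefficient vectors `c`,
`√(∑ j, ‖φ j y‖²) ≤ γ' ‖y‖` for all `y`, and `√(∑ i, ‖(N *ᵥ c) i‖²) ≤ ν √(∑ ‖c i‖²)` for all `c`, then
`‖finiteRank w (fun i => ∑ j, N i j • φ j)‖ ≤ γ * ν * γ'`. [folklore] -/
theorem norm_finiteRank_mulVec_le (w : ι → E) (φ : ι → E →L[𝕜] 𝕜) (N : Matrix ι ι 𝕜) {γ γ' ν : ℝ}
    (hγ : 0 ≤ γ) (hν : 0 ≤ ν) (hγ' : 0 ≤ γ')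
    (hw : ∀ c : ι → 𝕜, ‖∑ i, c i • w i‖ ≤ γ * Real.sqrt (∑ i, ‖c i‖ ^ 2))
    (hφ : ∀ y : E, Real.sqrt (∑ j, ‖φ j y‖ ^ 2) ≤ γ' * ‖y‖)
    (hN : ∀ c : ι → 𝕜, Real.sqrt (∑ i, ‖(N *ᵥ c) i‖ ^ 2) ≤ ν * Real.sqrt (∑ i, ‖c i‖ ^ 2)) :
    ‖finiteRank w (fun i => ∑ j, N i j • φ j)‖ ≤ γ * ν * γ' := by
  refine ContinuousLinearMap.opNorm_le_bound _ (by positivity) fun y => ?_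
  set v : ι → 𝕜 := fun j => φ j y with hv
  have h1 : finiteRank w (fun i => ∑ j, N i j • φ j) y = ∑ i, (N *ᵥ v) i • w i := by
    rw [finiteRank_apply]
    simp only [sum_smul_apply_eq_mulVec, hv]
  rw [h1]
  calc ‖∑ i, (N *ᵥ v) i • w i‖ ≤ γ * Real.sqrt (∑ i, ‖(N *ᵥ v) i‖ ^ 2) := hw _
    _ ≤ γ * (ν * Real.sqrt (∑ i, ‖v i‖ ^ 2)) := mul_le_mul_of_nonneg_left (hN v) hγ
    _ ≤ γ * (ν * (γ' * ‖y‖)) :=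
        mul_le_mul_of_nonneg_left (mul_le_mul_of_nonneg_left (hφ y) hν) hγ
    _ = γ * ν * γ' * ‖y‖ := by ring

end Literature.Analysis.OperatorTheory
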